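import Summits.BirchSwinnertonDyer.BirchSwinnertonDyer.Theorems.ManinLocalTwoThreeTwistDefectRootDatum

/-!
# THE DEFECT LAW OF THE TWIST GROUPOID, part 8: the TYPED FAMILY PROPS of the squeeze / root-datum / η-rooted transports and their
instances (desc g46 MEMO-desc §71, E-desc-242 `SqueezeTransportTwoTwistFrom`, E-desc-243 `SqueezeTransportNegOneTwistFrom`, E-desc-244
`RootDatumTransportNegOne`, E-desc-245 `EtaRootedTransportOneTwelve`; T-desc-58 FINAL sha16 ea245f8823aa6498; landed by p1 gen 25).  Every
instance is a THEOREM of parts 5–7 (`squeezeTransportTwoTwistFrom_of/_families`, `squeezeTransportNegOneTwistFrom_of/_families`,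
`rootDatumTransportNegOne_families`, `etaRootedTransport_oneTwelve`).  No named fact; C2, Manin's conjecture and BSD NOT proved.
[cite: Stevens1989, Lemma (5.4) p. 97] [cite: Pal2012, Lemma 3.1] [cite: EdixhovenManin1991, Prop. 2]
-/

set_option autoImplicit false
-- the summit-side namespace `Summit.BirchSwinnertonDyer.BirchSwinnertonDyer.…` is the tree's (summit = sub-problem)
set_option linter.dupNamespace false

noncomputable section

open scoped Classical NumberField MatrixGroups ModularForm

namespace Summit.BirchSwinnertonDyer.BirchSwinnertonDyer.Theorems.ManinLocalTwoThree.TwistDefect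

open WeierstrassCurve CongruenceSubgroup IsDedekindDomain IsDedekindDomain.HeightOneSpectrum Rat.HeightOneSpectrum
  Literature.NumberTheory.Automorphic Literature.NumberTheory.EllipticCurves Literature.NumberTheory.EllipticCurves.ModularForms
  Literature.NumberTheory.LFunctions.PrimitiveQuadratic Summit.BirchSwinnertonDyer.BirchSwinnertonDyer.Theorems
  Summit.BirchSwinnertonDyer.BirchSwinnertonDyer.Theorems.ManinLocalTwoThree Summit.BirchSwinnertonDyer.Rank1Residual.ManinAdditive
  Summit.BirchSwinnertonDyer.BirchSwinnertonDyer.Theorems.ManinLocalTwoThree.TwistFamilies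
  Summit.BirchSwinnertonDyer.BirchSwinnertonDyer.Theorems.ManinLocalTwoThree.AdditiveTwistFamilies
  Summit.BirchSwinnertonDyer.BirchSwinnertonDyer.Theorems.ManinLocalTwoThree.EtaParity

/-! ## Family predicates of parts 5–6 (E-desc-242 / E-desc-243) -/

/-- **E-desc-242 (typed candidate Prop): LEVEL-FREE SQUEEZE TRANSPORT from root level `M` to member
level `N` for `d = ±2`.**  A THEOREM whenever `4 ∣ M`, `M ∣ N`, `64 ∣ N` (`squeezeTransportTwoTwistFrom_of`). -/
def SqueezeTransportTwoTwistFrom (M N : ℕ) [NeZero M] [NeZero N] (d : ℤ) : Prop :=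
  ∀ (f₀ : CuspForm (Gamma0 M) 2) (W₀ : WeierstrassCurve ℚ) [W₀.IsElliptic] (L₀ : PeriodPair),
    IsNeronLatticeOf (W₀.baseChange ℂ) L₀ → (∀ z ∈ periodLattice f₀, z ∈ L₀.lattice) →
    (∀ n : ℕ, 2 ∣ n → cuspCoeff f₀ n = 0) →
    ∀ (C : WeierstrassCurve ℚ) [C.IsElliptic] [C.IsGloballyMinimal] (u : VariableChange ℚ) (r : ℤ),
      u • W₀.quadraticTwist (d : ℚ) = C → (r = 1 ∨ r = -1) → (r : ℚ) ^ 12 * C.Δ = (d : ℚ) ^ 6 * W₀.Δ →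
      ∀ (W : WeierstrassCurve ℚ) [W.IsElliptic] [W.IsGloballyMinimal] (D : ModularParametrizationData W N),
        (∀ n : ℕ, ¬ 2 ∣ n →
          cuspCoeff D.f n = ((if d = 2 then ZMod.χ₈ n else ZMod.χ₈' n : ℤ) : ℂ) * cuspCoeff f₀ n) →
        (∀ z ∈ D.L.lattice, ∃ w ∈ periodLattice D.f, z = D.c * w) → |D.maninConstant| = 1

/-- **E-desc-242 holds** whenever `4 ∣ M`, `M ∣ N`, `64 ∣ N` (from `abs_maninConstant_eq_one_of_squeeze_twoTwist_aligned_level`). -/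
theorem squeezeTransportTwoTwistFrom_of {M : ℕ} [NeZero M] (h4M : 4 ∣ M) {N : ℕ} [NeZero N]
    (hMN : M ∣ N) (h64N : 8 ^ 2 ∣ N) {d : ℤ} (hd : d = 2 ∨ d = -2) : SqueezeTransportTwoTwistFrom M N d :=
  fun f₀ W₀ _ L₀ hL₀ hS0 heven _C _ _ u _r hu hr hΔ W _ _ D hf hopt ↦
    abs_maninConstant_eq_one_of_squeeze_twoTwist_aligned_level hd h4M hMN h64N f₀ W₀ L₀ hL₀ hS0 heven u
      hu hr hΔ W D hf hopt

/-- **E-desc-242 on the census's aligned `±8`-families with an explicit root squeeze in the tree:**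
`(24,192)`, `(48,192)`, `(96,192)`, `(20,320)`, `(40,320)`, `(80,320)`, `(56,448)`, `(36,576)`, `(72,576)`,
`(144,576)`, `(44,704)`, `(52,832)`, `(108,1728)`, and `(128,128)`. -/
theorem squeezeTransportTwoTwistFrom_families {d : ℤ} (hd : d = 2 ∨ d = -2) :
    SqueezeTransportTwoTwistFrom 24 192 d ∧ SqueezeTransportTwoTwistFrom 48 192 d ∧
    SqueezeTransportTwoTwistFrom 96 192 d ∧ SqueezeTransportTwoTwistFrom 20 320 d ∧
    SqueezeTransportTwoTwistFrom 40 320 d ∧ SqueezeTransportTwoTwistFrom 80 320 d ∧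
    SqueezeTransportTwoTwistFrom 56 448 d ∧ SqueezeTransportTwoTwistFrom 36 576 d ∧
    SqueezeTransportTwoTwistFrom 72 576 d ∧ SqueezeTransportTwoTwistFrom 144 576 d ∧
    SqueezeTransportTwoTwistFrom 44 704 d ∧ SqueezeTransportTwoTwistFrom 52 832 d ∧
    SqueezeTransportTwoTwistFrom 108 1728 d ∧ SqueezeTransportTwoTwistFrom 128 128 d :=
  ⟨squeezeTransportTwoTwistFrom_of ⟨6, rfl⟩ ⟨8, rfl⟩ ⟨3, rfl⟩ hd,
    squeezeTransportTwoTwistFrom_of ⟨12, rfl⟩ ⟨4, rfl⟩ ⟨3, rfl⟩ hd,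
    squeezeTransportTwoTwistFrom_of ⟨24, rfl⟩ ⟨2, rfl⟩ ⟨3, rfl⟩ hd,
    squeezeTransportTwoTwistFrom_of ⟨5, rfl⟩ ⟨16, rfl⟩ ⟨5, rfl⟩ hd,
    squeezeTransportTwoTwistFrom_of ⟨10, rfl⟩ ⟨8, rfl⟩ ⟨5, rfl⟩ hd,
    squeezeTransportTwoTwistFrom_of ⟨20, rfl⟩ ⟨4, rfl⟩ ⟨5, rfl⟩ hd,
    squeezeTransportTwoTwistFrom_of ⟨14, rfl⟩ ⟨8, rfl⟩ ⟨7, rfl⟩ hd,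
    squeezeTransportTwoTwistFrom_of ⟨9, rfl⟩ ⟨16, rfl⟩ ⟨9, rfl⟩ hd,
    squeezeTransportTwoTwistFrom_of ⟨18, rfl⟩ ⟨8, rfl⟩ ⟨9, rfl⟩ hd,
    squeezeTransportTwoTwistFrom_of ⟨36, rfl⟩ ⟨4, rfl⟩ ⟨9, rfl⟩ hd,
    squeezeTransportTwoTwistFrom_of ⟨11, rfl⟩ ⟨16, rfl⟩ ⟨11, rfl⟩ hd,
    squeezeTransportTwoTwistFrom_of ⟨13, rfl⟩ ⟨16, rfl⟩ ⟨13, rfl⟩ hd,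
    squeezeTransportTwoTwistFrom_of ⟨27, rfl⟩ ⟨16, rfl⟩ ⟨27, rfl⟩ hd,
    squeezeTransportTwoTwistFrom_of ⟨32, rfl⟩ ⟨1, rfl⟩ ⟨2, rfl⟩ hd⟩

/-- **E-desc-243 (typed candidate Prop): SQUEEZE TRANSPORT along `χ₋₄` from root level `M` to member level `N`.**
A THEOREM whenever `4 ∣ M`, `M ∣ N`, `16 ∣ N` (`squeezeTransportNegOneTwistFrom_of`). -/
def SqueezeTransportNegOneTwistFrom (M N : ℕ) [NeZero M] [NeZero N] : Prop :=
  ∀ (f₀ : CuspForm (Gamma0 M) 2) (W₀ : WeierstrassCurve ℚ) [W₀.IsElliptic] (L₀ : PeriodPair),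
    IsNeronLatticeOf (W₀.baseChange ℂ) L₀ → (∀ z ∈ periodLattice f₀, z ∈ L₀.lattice) →
    (∀ n : ℕ, 2 ∣ n → cuspCoeff f₀ n = 0) →
    ∀ (C : WeierstrassCurve ℚ) [C.IsElliptic] [C.IsGloballyMinimal] (u : VariableChange ℚ) (r : ℤ),
      u • W₀.quadraticTwist (-1) = C → (r = 1 ∨ r = -1) → (r : ℚ) ^ 12 * C.Δ = W₀.Δ →
      ∀ (W : WeierstrassCurve ℚ) [W.IsElliptic] [W.IsGloballyMinimal] (D : ModularParametrizationData W N),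
        (∀ n : ℕ, ¬ 2 ∣ n → cuspCoeff D.f n = (ZMod.χ₄ n : ℂ) * cuspCoeff f₀ n) →
        (∀ z ∈ D.L.lattice, ∃ w ∈ periodLattice D.f, z = D.c * w) → |D.maninConstant| = 1

/-- **E-desc-243 holds** whenever `4 ∣ M`, `M ∣ N`, `16 ∣ N` (from `abs_maninConstant_eq_one_of_squeeze_negOneTwist_aligned_level`). -/
theorem squeezeTransportNegOneTwistFrom_of {M : ℕ} [NeZero M] (h4M : 4 ∣ M) {N : ℕ} [NeZero N]
    (hMN : M ∣ N) (h16N : 4 ^ 2 ∣ N) : SqueezeTransportNegOneTwistFrom M N :=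
  fun f₀ W₀ _ L₀ hL₀ hS0 heven _C _ _ u _r hu hr hΔ W _ _ D hf hopt ↦
    abs_maninConstant_eq_one_of_squeeze_negOneTwist_aligned_level h4M hMN h16N f₀ W₀ L₀ hL₀ hS0 heven u hu
      hr hΔ W D hf hopt

/-- E-desc-243 on the census's `χ₋₄`-families: `(56,112)`, `(72,144)`, `(36,144)`, `(44,176)`, `(52,208)`,
`(108,432)`, `(128,128)`, `(20,80)`, `(40,80)`, `(24,48)`. -/
theorem squeezeTransportNegOneTwistFrom_families :
    SqueezeTransportNegOneTwistFrom 56 112 ∧ SqueezeTransportNegOneTwistFrom 72 144 ∧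
    SqueezeTransportNegOneTwistFrom 36 144 ∧ SqueezeTransportNegOneTwistFrom 44 176 ∧
    SqueezeTransportNegOneTwistFrom 52 208 ∧ SqueezeTransportNegOneTwistFrom 108 432 ∧
    SqueezeTransportNegOneTwistFrom 128 128 ∧ SqueezeTransportNegOneTwistFrom 20 80 ∧
    SqueezeTransportNegOneTwistFrom 40 80 ∧ SqueezeTransportNegOneTwistFrom 24 48 :=
  ⟨squeezeTransportNegOneTwistFrom_of ⟨14, rfl⟩ ⟨2, rfl⟩ ⟨7, rfl⟩,
    squeezeTransportNegOneTwistFrom_of ⟨18, rfl⟩ ⟨2, rfl⟩ ⟨9, rfl⟩,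
    squeezeTransportNegOneTwistFrom_of ⟨9, rfl⟩ ⟨4, rfl⟩ ⟨9, rfl⟩,
    squeezeTransportNegOneTwistFrom_of ⟨11, rfl⟩ ⟨4, rfl⟩ ⟨11, rfl⟩,
    squeezeTransportNegOneTwistFrom_of ⟨13, rfl⟩ ⟨4, rfl⟩ ⟨13, rfl⟩,
    squeezeTransportNegOneTwistFrom_of ⟨27, rfl⟩ ⟨4, rfl⟩ ⟨27, rfl⟩,
    squeezeTransportNegOneTwistFrom_of ⟨32, rfl⟩ ⟨1, rfl⟩ ⟨8, rfl⟩,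
    squeezeTransportNegOneTwistFrom_of ⟨5, rfl⟩ ⟨4, rfl⟩ ⟨5, rfl⟩,
    squeezeTransportNegOneTwistFrom_of ⟨10, rfl⟩ ⟨2, rfl⟩ ⟨5, rfl⟩,
    squeezeTransportNegOneTwistFrom_of ⟨6, rfl⟩ ⟨2, rfl⟩ ⟨3, rfl⟩⟩

/-- **E-desc-244 (typed candidate Prop): ROOT-DATUM SQUEEZE TRANSPORT along `χ₋₄`** — the form in which the
LEAD consumes 71.J: a root datum at the complete level `M`, a member datum at `N`, the twisted odd-coefficient
relation.  THEOREM at `(56,112)`, `(72,144)`, `(44,176)`, `(108,432)` (`rootDatumTransportNegOne_families`). -/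
def RootDatumTransportNegOne (M N : ℕ) [NeZero M] [NeZero N] : Prop :=
  ∀ (W₀ : WeierstrassCurve ℚ) [W₀.IsElliptic] [W₀.IsGloballyMinimal] (D₀ : ModularParametrizationData W₀ M)
    (W : WeierstrassCurve ℚ) [W.IsElliptic] [W.IsGloballyMinimal] (D : ModularParametrizationData W N),
    (∀ n : ℕ, ¬ 2 ∣ n → cuspCoeff D.f n = (ZMod.χ₄ n : ℂ) * cuspCoeff D₀.f n) →
    (∀ z ∈ D.L.lattice, ∃ w ∈ periodLattice D.f, z = D.c * w) → |D.maninConstant| = 1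

/-- Auxiliary step `rootDatumTransportNegOne_families` of the twist-defect squeeze transport (see the module docstring). -/
theorem rootDatumTransportNegOne_families :
    RootDatumTransportNegOne 56 112 ∧ RootDatumTransportNegOne 72 144 ∧
    RootDatumTransportNegOne 44 176 ∧ RootDatumTransportNegOne 108 432 :=
  ⟨fun W₀ _ _ D₀ W _ _ D hf hopt ↦ abs_maninConstant_eq_one_oneTwelve_of_rootDatum W₀ D₀ W D hf hopt,
    fun W₀ _ _ D₀ W _ _ D hf hopt ↦ abs_maninConstant_eq_one_oneFortyFourB_of_rootDatum W₀ D₀ W D hf hopt,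
    fun W₀ _ _ D₀ W _ _ D hf hopt ↦ abs_maninConstant_eq_one_oneSeventySixC_of_rootDatum W₀ D₀ W D hf hopt,
    fun W₀ _ _ D₀ W _ _ D hf hopt ↦ abs_maninConstant_eq_one_fourThirtyTwoB_of_rootDatum W₀ D₀ W D hf hopt⟩

/-- **E-desc-245 (typed candidate Prop): η-ROOTED SQUEEZE TRANSPORT at (56 → 112)** — the sign-free, datum-free form:
for p3's `P`, `Q`, every lattice-optimal `X₀(112)`-datum whose odd coefficients are `χ₋₄`-twists of those of `P − Q`
or of `P + Q` has `|c| = 1`.  THEOREM (`etaRootedTransport_oneTwelve`). -/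
def EtaRootedTransportOneTwelve : Prop :=
  ∀ (P Q : CuspForm (Gamma0 56) 2), ⇑P = etaQuotient 56 (expFn [(2, -1), (4, 3), (14, 3), (28, -1)]) →
    ⇑Q = etaQuotient 56 (expFn [(2, 3), (4, -1), (14, -1), (28, 3)]) →
    ∀ (W : WeierstrassCurve ℚ) [W.IsElliptic] [W.IsGloballyMinimal] (D : ModularParametrizationData W 112),
    ((∀ n : ℕ, ¬ 2 ∣ n → cuspCoeff D.f n = (ZMod.χ₄ n : ℂ) * cuspCoeff (P - Q) n) ∨
      (∀ n : ℕ, ¬ 2 ∣ n → cuspCoeff D.f n = (ZMod.χ₄ n : ℂ) * cuspCoeff (P + Q) n)) →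
    (∀ z ∈ D.L.lattice, ∃ w ∈ periodLattice D.f, z = D.c * w) →
    ¬ (2 : ℤ) ∣ D.maninConstant ∧ ¬ (3 : ℤ) ∣ D.maninConstant

/-- Auxiliary step `etaRootedTransport_oneTwelve` of the twist-defect squeeze transport (see the module docstring). -/
theorem etaRootedTransport_oneTwelve : EtaRootedTransportOneTwelve :=
  fun P Q hP hQ W _ _ D hf hopt ↦ not_dvd_maninConstant_oneTwelve_of_eta P Q hP hQ W D hf hopt

end Summit.BirchSwinnertonDyer.BirchSwinnertonDyer.Theorems.ManinLocalTwoThree.TwistDefect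

end
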